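import Literature.NumberTheory.Automorphic.MatrixTwoIntegralConjugacy
import Literature.NumberTheory.Automorphic.AdelePlacesIdempotent
import Literature.NumberTheory.Automorphic.QuaternionAlgebraAdelicRamificationProofs
import HarnessLib

/-!
# Conjugacy in `GL₂(𝔸_K)` away from `S` of two adelic matrices with the same separable rational
# characteristic polynomial

Topic `NumberTheory/Automorphic`; small definitions with bodies (`infiniteAdeleEval`,
`adeleOfLocal`, `matrixAdeleOfLocal`) and theorems; no named fact, no instance.

Let `t, n ∈ K` with `t² - 4n ≠ 0` (a separable quadratic `X² - tX + n`), `S` a finite set of finite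
places, and `A, B ∈ M₂(𝔸_K)` two adelic matrices whose components at every infinite place and at every
finite place `w ∉ S` have trace `t` and determinant `n`. Then **there is `Q ∈ GL₂(𝔸_K)` with
`(Q A Q⁻¹)_w = B_w` at all those places** (`exists_units_conj_eq_away`): at each place the two
components are non-scalar with the same trace and determinant, hence conjugate over the local field
(`exists_units_conj_eq_of_trace_eq_of_det_eq`, `MatrixTwoConjugacy`); at the cofinitely many finite
places where `A_w`, `B_w` are integral and `t² - 4n` is a unit the conjugator can be taken in
`GL₂(𝒪_w)` (`exists_units_conj_eq_of_isUnit_discr`, `MatrixTwoIntegralConjugacy`), so that the local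
conjugators (and their inverses) assemble to an adelic matrix (`matrixAdeleOfLocal`).

This is the adelic content of the identification of the elliptic terms indexed by `γ' ∈ Dˣ` and
`γ ∈ GL₂(K)` with the same characteristic polynomial in Gelbart's comparison (10.14) = (10.15)
(Gelbart (1975), §10, p. 155: the orbital integrals over `B'^S \ G'^S` and `B^S \ G^S` are identified
through `G'^S = G^S`), descended to `GL₂(𝔸_K^S)` in `AdeleAwayMatrixTwoConjugacy`. Part of the inline
(D-0026) decomposition of `Literature.NumberTheory.Automorphic.strong_multiplicity_one_quaternionUnits`.

## References

* S. Gelbart, *Automorphic forms on adele groups*, Ann. of Math. Studies 83 (1975), §10, p. 155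
  [Gelbart1975].
* J. W. S. Cassels, A. Fröhlich (eds.), *Algebraic Number Theory* (1967), Ch. II §14 (adeles as
  restricted products) [CasselsFrohlichANT1967].
-/

noncomputable section

open NumberField IsDedekindDomain Matrix

namespace Literature.NumberTheory.Automorphic

/-! ### Local conjugacy from the discriminant -/

section Local

variable {F : Type*} [Field F]

/-- A `2 × 2` matrix with non-zero discriminant `tr² - 4 det` is not scalar. [folklore] -/
theorem not_mem_bot_of_discr_ne_zero {A : Matrix (Fin 2) (Fin 2) F} (h : A.trace ^ 2 - 4 * A.det ≠ 0) :
    A ∉ (⊥ : Subalgebra F (Matrix (Fin 2) (Fin 2) F)) := by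
  intro hA
  obtain ⟨c, hc⟩ := Algebra.mem_bot.1 hA
  apply h
  rw [← hc, Algebra.algebraMap_eq_smul_one, Matrix.trace_smul, Matrix.trace_one, Matrix.det_smul, Matrix.det_one,
    Fintype.card_fin]
  simp only [smul_eq_mul, mul_one, Nat.cast_ofNat]
  ring

/-- **Local conjugacy**: over a field, two `2 × 2` matrices with the same trace `t` and determinant `n`
and `t² - 4n ≠ 0` are conjugate under `GL₂(F)`. [folklore] -/
theorem exists_units_conj_eq_of_discr_ne_zero (A B : Matrix (Fin 2) (Fin 2) F) (ht : A.trace = B.trace)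
    (hd : A.det = B.det) (h : A.trace ^ 2 - 4 * A.det ≠ 0) :
    ∃ g : GL (Fin 2) F, (g : Matrix (Fin 2) (Fin 2) F) * A * ((g⁻¹ : GL (Fin 2) F) : Matrix (Fin 2) (Fin 2) F) = B :=
  exists_units_conj_eq_of_trace_eq_of_det_eq (not_mem_bot_of_discr_ne_zero h)
    (not_mem_bot_of_discr_ne_zero (by rwa [← ht, ← hd])) ht hd

end Local

/-! ### Integral conjugacy at a good finite place -/

section Integral

variable (K : Type) [Field K] [NumberField K] (w : HeightOneSpectrum (𝓞 K))

/-- A `K_w`-matrix with integral entries, as a matrix over `𝒪_w`. [folklore] -/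
def matrixOfIntegral (A : Matrix (Fin 2) (Fin 2) (w.adicCompletion K)) (hA : ∀ i j, A i j ∈ w.adicCompletionIntegers K) :
    Matrix (Fin 2) (Fin 2) (w.adicCompletionIntegers K) :=
  Matrix.of fun i j => ⟨A i j, hA i j⟩

/-- `matrixOfIntegral A` maps back to `A` under the inclusion `𝒪_w ⊆ K_w`. [folklore] -/
theorem matrixOfIntegral_map (A : Matrix (Fin 2) (Fin 2) (w.adicCompletion K)) (hA : ∀ i j, A i j ∈ w.adicCompletionIntegers K) :
    (matrixOfIntegral K w A hA).map (w.adicCompletionIntegers K).subtype = A := by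
  ext i j
  rfl

/-- **Integral conjugacy at a good place**: two `K_w`-matrices with integral entries, the same trace
`t` and determinant `n` (`t, n ∈ K`) and `v_w(t² - 4n) = 0` are conjugate by some `g ∈ GL₂(K_w)` with
`g` and `g⁻¹` integral (`exists_units_conj_eq_of_isUnit_discr` over `𝒪_w`). [folklore] -/
theorem exists_integral_units_conj_eq {t n : K} (hdisc : w.valuation K (t ^ 2 - 4 * n) = 1)
    (A B : Matrix (Fin 2) (Fin 2) (w.adicCompletion K))
    (hA : ∀ i j, A i j ∈ w.adicCompletionIntegers K) (hB : ∀ i j, B i j ∈ w.adicCompletionIntegers K)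
    (hAt : A.trace = algebraMap K _ t) (hAd : A.det = algebraMap K _ n)
    (hBt : B.trace = algebraMap K _ t) (hBd : B.det = algebraMap K _ n) :
    ∃ g : GL (Fin 2) (w.adicCompletion K),
      (∀ i j, (g : Matrix (Fin 2) (Fin 2) (w.adicCompletion K)) i j ∈ w.adicCompletionIntegers K) ∧
      (∀ i j, ((g⁻¹ : GL (Fin 2) (w.adicCompletion K)) : Matrix (Fin 2) (Fin 2) (w.adicCompletion K)) i j ∈
        w.adicCompletionIntegers K) ∧
      (g : Matrix (Fin 2) (Fin 2) (w.adicCompletion K)) * A *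
        ((g⁻¹ : GL (Fin 2) (w.adicCompletion K)) : Matrix (Fin 2) (Fin 2) (w.adicCompletion K)) = B := by
  let ι := (w.adicCompletionIntegers K).subtype
  have hinj : Function.Injective ι := Subtype.val_injective
  have hmapA : (matrixOfIntegral K w A hA).map ι = A := matrixOfIntegral_map K w A hA
  have hmapB : (matrixOfIntegral K w B hB).map ι = B := matrixOfIntegral_map K w B hB
  have htr : ∀ M : Matrix (Fin 2) (Fin 2) (w.adicCompletionIntegers K), ι M.trace = (M.map ι).trace :=
    fun M => AddMonoidHom.map_trace ι M
  have hde : ∀ M : Matrix (Fin 2) (Fin 2) (w.adicCompletionIntegers K), ι M.det = (M.map ι).det :=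
    fun M => RingHom.map_det ι M
  have ht : (matrixOfIntegral K w A hA).trace = (matrixOfIntegral K w B hB).trace :=
    hinj (by rw [htr, htr, hmapA, hmapB, hAt, hBt])
  have hd : (matrixOfIntegral K w A hA).det = (matrixOfIntegral K w B hB).det :=
    hinj (by rw [hde, hde, hmapA, hmapB, hAd, hBd])
  -- the discriminant is a unit of `𝒪_w`
  have hval : ∀ c : K, Valued.v (algebraMap K (w.adicCompletion K) c) = w.valuation K c :=
    fun c ↦ HeightOneSpectrum.valuedAdicCompletion_eq_valuation' w c
  have hint : (Valued.v (R := w.adicCompletion K)).Integers (w.adicCompletionIntegers K) := Valuation.integer.integers _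
  have hdiscF : ι ((matrixOfIntegral K w A hA).trace ^ 2 - 4 * (matrixOfIntegral K w A hA).det) =
      algebraMap K (w.adicCompletion K) (t ^ 2 - 4 * n) := by
    rw [map_sub, map_pow, map_mul, map_ofNat, htr, hde, hmapA, hAt, hAd, map_sub, map_pow, map_mul, map_ofNat]
  have hunit : IsUnit ((matrixOfIntegral K w A hA).trace ^ 2 - 4 * (matrixOfIntegral K w A hA).det) := by
    refine hint.isUnit_iff_valuation_eq_one.mpr ?_
    change Valued.v (ι ((matrixOfIntegral K w A hA).trace ^ 2 - 4 * (matrixOfIntegral K w A hA).det)) = 1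
    rw [hdiscF, hval, hdisc]
  obtain ⟨Q, hQ⟩ := exists_units_conj_eq_of_isUnit_discr _ _ ht hd hunit
  refine ⟨Matrix.GeneralLinearGroup.map ι Q, fun i j => ?_, fun i j => ?_, ?_⟩
  · exact ((Q : Matrix (Fin 2) (Fin 2) (w.adicCompletionIntegers K)) i j).2
  · rw [← map_inv]
    exact (((Q⁻¹ : GL (Fin 2) (w.adicCompletionIntegers K)) : Matrix (Fin 2) (Fin 2) (w.adicCompletionIntegers K)) i j).2
  · have h := congrArg (fun M : Matrix (Fin 2) (Fin 2) (w.adicCompletionIntegers K) => M.map ι) hQ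
    simp only [Matrix.map_mul] at h
    rw [hmapA, hmapB] at h
    rw [← map_inv]
    exact h

end Integral

/-! ### Adelic matrices from local data -/

section Assembly

variable (K : Type) [Field K] [NumberField K]

/-- The component at an infinite place, as a ring homomorphism `𝔸_K →+* K_w`. [folklore] -/
def infiniteAdeleEval (w : InfinitePlace K) : AdeleRing (𝓞 K) K →+* w.Completion where
  toFun a := a.1 w
  map_one' := rfl
  map_mul' _ _ := rfl
  map_zero' := rfl
  map_add' _ _ := rfl

/-- `infiniteAdeleEval K w a = a.1 w` (definitional). [folklore] -/
@[simp]
theorem infiniteAdeleEval_apply (w : InfinitePlace K) (a : AdeleRing (𝓞 K) K) : infiniteAdeleEval K w a = a.1 w := rfl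

/-- The `w`-component of a principal adele at an infinite place. [folklore] -/
theorem infiniteAdeleEval_algebraMap (w : InfinitePlace K) (c : K) :
    infiniteAdeleEval K w (algebraMap K (AdeleRing (𝓞 K) K) c) = algebraMap K w.Completion c := rfl

/-- The `w`-component of a principal adele at a finite place. [folklore] -/
theorem adeleEval_algebraMap'' (w : HeightOneSpectrum (𝓞 K)) (c : K) :
    AdelicGroupData.adeleEval K w (algebraMap K (AdeleRing (𝓞 K) K) c) = algebraMap K (w.adicCompletion K) c := by
  rw [AdelicGroupData.adeleEval_apply]
  change algebraMap K (FiniteAdeleRing (𝓞 K) K) c w = _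
  rw [FiniteAdeleRing.algebraMap_apply]
  exact adicCompletion_coe_eq_algebraMap (𝓞 K) K w c

/-- **Two adeles agree iff all their components (infinite and finite) agree.** [folklore] -/
theorem adele_ext {x y : AdeleRing (𝓞 K) K} (hi : ∀ w : InfinitePlace K, infiniteAdeleEval K w x = infiniteAdeleEval K w y)
    (hf : ∀ w : HeightOneSpectrum (𝓞 K), AdelicGroupData.adeleEval K w x = AdelicGroupData.adeleEval K w y) : x = y :=
  AdeleRing.ext' K (funext hi) hf

/-- **An adele from local data**: components `x_w` at the finite places, integral at cofinitely many
of them, and `x_∞` at the infinite places. [folklore] -/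
def adeleOfLocal (xi : ∀ w : InfinitePlace K, w.Completion) (x : ∀ w : HeightOneSpectrum (𝓞 K), w.adicCompletion K)
    (hx : ∀ᶠ w in Filter.cofinite, x w ∈ w.adicCompletionIntegers K) : AdeleRing (𝓞 K) K :=
  (xi, ⟨x, hx⟩)

/-- Components of `adeleOfLocal` at finite places (definitional). [folklore] -/
@[simp]
theorem adeleEval_adeleOfLocal (xi : ∀ w : InfinitePlace K, w.Completion) (x : ∀ w : HeightOneSpectrum (𝓞 K), w.adicCompletion K)
    (hx : ∀ᶠ w in Filter.cofinite, x w ∈ w.adicCompletionIntegers K) (w : HeightOneSpectrum (𝓞 K)) :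
    AdelicGroupData.adeleEval K w (adeleOfLocal K xi x hx) = x w := rfl

/-- Components of `adeleOfLocal` at infinite places (definitional). [folklore] -/
@[simp]
theorem infiniteAdeleEval_adeleOfLocal (xi : ∀ w : InfinitePlace K, w.Completion)
    (x : ∀ w : HeightOneSpectrum (𝓞 K), w.adicCompletion K)
    (hx : ∀ᶠ w in Filter.cofinite, x w ∈ w.adicCompletionIntegers K) (w : InfinitePlace K) :
    infiniteAdeleEval K w (adeleOfLocal K xi x hx) = xi w := rfl

/-- **An adelic `2 × 2` matrix from local matrices**, integral at cofinitely many finite places. [folklore] -/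
def matrixAdeleOfLocal (Mi : ∀ w : InfinitePlace K, Matrix (Fin 2) (Fin 2) w.Completion)
    (M : ∀ w : HeightOneSpectrum (𝓞 K), Matrix (Fin 2) (Fin 2) (w.adicCompletion K))
    (hM : ∀ᶠ w in Filter.cofinite, ∀ i j, M w i j ∈ w.adicCompletionIntegers K) :
    Matrix (Fin 2) (Fin 2) (AdeleRing (𝓞 K) K) :=
  Matrix.of fun i j => adeleOfLocal K (fun w => Mi w i j) (fun w => M w i j) (hM.mono fun _ h => h i j)

/-- Finite components of `matrixAdeleOfLocal`. [folklore] -/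
@[simp]
theorem matrixAdeleOfLocal_map_adeleEval (Mi : ∀ w : InfinitePlace K, Matrix (Fin 2) (Fin 2) w.Completion)
    (M : ∀ w : HeightOneSpectrum (𝓞 K), Matrix (Fin 2) (Fin 2) (w.adicCompletion K))
    (hM : ∀ᶠ w in Filter.cofinite, ∀ i j, M w i j ∈ w.adicCompletionIntegers K) (w : HeightOneSpectrum (𝓞 K)) :
    (matrixAdeleOfLocal K Mi M hM).map (AdelicGroupData.adeleEval K w) = M w := by
  ext i j
  rfl

/-- Infinite components of `matrixAdeleOfLocal`. [folklore] -/
@[simp]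
theorem matrixAdeleOfLocal_map_infiniteAdeleEval (Mi : ∀ w : InfinitePlace K, Matrix (Fin 2) (Fin 2) w.Completion)
    (M : ∀ w : HeightOneSpectrum (𝓞 K), Matrix (Fin 2) (Fin 2) (w.adicCompletion K))
    (hM : ∀ᶠ w in Filter.cofinite, ∀ i j, M w i j ∈ w.adicCompletionIntegers K) (w : InfinitePlace K) :
    (matrixAdeleOfLocal K Mi M hM).map (infiniteAdeleEval K w) = Mi w := by
  ext i j
  rfl

/-- **Two adelic matrices agree iff all their local components agree.** [folklore] -/
theorem matrix_adele_ext {A B : Matrix (Fin 2) (Fin 2) (AdeleRing (𝓞 K) K)}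
    (hi : ∀ w : InfinitePlace K, A.map (infiniteAdeleEval K w) = B.map (infiniteAdeleEval K w))
    (hf : ∀ w : HeightOneSpectrum (𝓞 K), A.map (AdelicGroupData.adeleEval K w) = B.map (AdelicGroupData.adeleEval K w)) :
    A = B := by
  ext i j
  exact adele_ext K (fun w => congrFun (congrFun (hi w) i) j) (fun w => congrFun (congrFun (hf w) i) j)

/-- The entries of an adelic matrix are integral at cofinitely many finite places. [folklore] -/
theorem eventually_forall_mem_adicCompletionIntegers (A : Matrix (Fin 2) (Fin 2) (AdeleRing (𝓞 K) K)) :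
    ∀ᶠ w in Filter.cofinite, ∀ i j, AdelicGroupData.adeleEval K w (A i j) ∈ w.adicCompletionIntegers K := by
  simp only [Filter.eventually_all]
  intro i j
  exact (A i j).2.2

/-- **Conjugacy in `GL₂(𝔸_K)` away from `S`.** Let `t, n ∈ K` with `t² - 4n ≠ 0`, `S` a finite set of
finite places, and `A, B ∈ M₂(𝔸_K)` with trace `t` and determinant `n` at every infinite place and
at every finite place outside `S`. Then some `Q ∈ GL₂(𝔸_K)` conjugates `A` into `B` at all these
places: `(Q A Q⁻¹)_w = B_w`. [cite: Gelbart1975, §10 p. 155] -/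
theorem exists_units_conj_eq_away (S : Finset (HeightOneSpectrum (𝓞 K))) {t n : K} (hdisc : t ^ 2 - 4 * n ≠ 0)
    (A B : Matrix (Fin 2) (Fin 2) (AdeleRing (𝓞 K) K))
    (hAi : ∀ w : InfinitePlace K, (A.map (infiniteAdeleEval K w)).trace = algebraMap K _ t ∧
      (A.map (infiniteAdeleEval K w)).det = algebraMap K _ n)
    (hBi : ∀ w : InfinitePlace K, (B.map (infiniteAdeleEval K w)).trace = algebraMap K _ t ∧
      (B.map (infiniteAdeleEval K w)).det = algebraMap K _ n)
    (hAf : ∀ w : HeightOneSpectrum (𝓞 K), w ∉ S → (A.map (AdelicGroupData.adeleEval K w)).trace = algebraMap K _ t ∧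
      (A.map (AdelicGroupData.adeleEval K w)).det = algebraMap K _ n)
    (hBf : ∀ w : HeightOneSpectrum (𝓞 K), w ∉ S → (B.map (AdelicGroupData.adeleEval K w)).trace = algebraMap K _ t ∧
      (B.map (AdelicGroupData.adeleEval K w)).det = algebraMap K _ n) :
    ∃ Q : GL (Fin 2) (AdeleRing (𝓞 K) K),
      (∀ w : InfinitePlace K, ((Q : Matrix (Fin 2) (Fin 2) (AdeleRing (𝓞 K) K)) * A *
          ((Q⁻¹ : GL (Fin 2) (AdeleRing (𝓞 K) K)) : Matrix (Fin 2) (Fin 2) (AdeleRing (𝓞 K) K))).map (infiniteAdeleEval K w) =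
        B.map (infiniteAdeleEval K w)) ∧
      ∀ w : HeightOneSpectrum (𝓞 K), w ∉ S → ((Q : Matrix (Fin 2) (Fin 2) (AdeleRing (𝓞 K) K)) * A *
          ((Q⁻¹ : GL (Fin 2) (AdeleRing (𝓞 K) K)) : Matrix (Fin 2) (Fin 2) (AdeleRing (𝓞 K) K))).map (AdelicGroupData.adeleEval K w) =
        B.map (AdelicGroupData.adeleEval K w) := by
  classical
  -- bad finite places: `S`, non-integral entries of `A` or `B`, discriminant not a unit
  have hdK : (t ^ 2 - 4 * n) ≠ 0 := hdisc
  set T : Set (HeightOneSpectrum (𝓞 K)) := {w | ¬ ∀ i j, AdelicGroupData.adeleEval K w (A i j) ∈ w.adicCompletionIntegers K} ∪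
    {w | ¬ ∀ i j, AdelicGroupData.adeleEval K w (B i j) ∈ w.adicCompletionIntegers K} ∪
    {w | w.valuation K (t ^ 2 - 4 * n) ≠ 1} ∪ (S : Set (HeightOneSpectrum (𝓞 K))) with hT
  have hTf : T.Finite :=
    (((Filter.eventually_cofinite.1 (eventually_forall_mem_adicCompletionIntegers K A)).union
      (Filter.eventually_cofinite.1 (eventually_forall_mem_adicCompletionIntegers K B))).union
      (finite_setOf_valuation_ne_one K hdK)).union S.finite_toSet
  -- local discriminants do not vanish
  have hdiscF : ∀ w : HeightOneSpectrum (𝓞 K), (algebraMap K (w.adicCompletion K) t) ^ 2 - 4 * algebraMap K _ n ≠ 0 := fun w h =>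
    hdK ((algebraMap K (w.adicCompletion K)).injective (by rw [map_sub, map_pow, map_mul, map_ofNat, h, map_zero]))
  have hdiscI : ∀ w : InfinitePlace K, (algebraMap K w.Completion t) ^ 2 - 4 * algebraMap K _ n ≠ 0 := fun w h =>
    hdK ((algebraMap K w.Completion).injective (by rw [map_sub, map_pow, map_mul, map_ofNat, h, map_zero]))
  -- local conjugators at the finite places
  have key : ∀ w : HeightOneSpectrum (𝓞 K), ∃ g : GL (Fin 2) (w.adicCompletion K),
      (w ∉ S → (g : Matrix (Fin 2) (Fin 2) (w.adicCompletion K)) * A.map (AdelicGroupData.adeleEval K w) *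
        ((g⁻¹ : GL (Fin 2) (w.adicCompletion K)) : Matrix (Fin 2) (Fin 2) (w.adicCompletion K)) =
          B.map (AdelicGroupData.adeleEval K w)) ∧
      (w ∉ T → (∀ i j, (g : Matrix (Fin 2) (Fin 2) (w.adicCompletion K)) i j ∈ w.adicCompletionIntegers K) ∧
        ∀ i j, ((g⁻¹ : GL (Fin 2) (w.adicCompletion K)) : Matrix (Fin 2) (Fin 2) (w.adicCompletion K)) i j ∈
          w.adicCompletionIntegers K) := by
    intro w
    by_cases hwT : w ∈ T
    · by_cases hwS : w ∈ S
      · exact ⟨1, fun h => (h hwS).elim, fun h => (h hwT).elim⟩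
      · obtain ⟨g, hg⟩ := exists_units_conj_eq_of_discr_ne_zero (A.map (AdelicGroupData.adeleEval K w))
          (B.map (AdelicGroupData.adeleEval K w)) (by rw [(hAf w hwS).1, (hBf w hwS).1]) (by rw [(hAf w hwS).2, (hBf w hwS).2])
          (by rw [(hAf w hwS).1, (hAf w hwS).2]; exact hdiscF w)
        exact ⟨g, fun _ => hg, fun h => (h hwT).elim⟩
    · have hw : (∀ i j, AdelicGroupData.adeleEval K w (A i j) ∈ w.adicCompletionIntegers K) ∧
          (∀ i j, AdelicGroupData.adeleEval K w (B i j) ∈ w.adicCompletionIntegers K) ∧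
          w.valuation K (t ^ 2 - 4 * n) = 1 ∧ w ∉ S := by
        simp only [hT, Set.mem_union, Set.mem_setOf_eq, not_or, not_not, Finset.mem_coe] at hwT
        exact ⟨hwT.1.1.1, hwT.1.1.2, hwT.1.2, hwT.2⟩
      obtain ⟨g, hg1, hg2, hg3⟩ := exists_integral_units_conj_eq K w hw.2.2.1 (A.map (AdelicGroupData.adeleEval K w))
        (B.map (AdelicGroupData.adeleEval K w)) (fun i j => hw.1 i j) (fun i j => hw.2.1 i j)
        (hAf w hw.2.2.2).1 (hAf w hw.2.2.2).2 (hBf w hw.2.2.2).1 (hBf w hw.2.2.2).2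
      exact ⟨g, fun _ => hg3, fun _ => ⟨hg1, hg2⟩⟩
  choose g hg using key
  -- local conjugators at the infinite places
  have keyi : ∀ w : InfinitePlace K, ∃ g : GL (Fin 2) w.Completion,
      (g : Matrix (Fin 2) (Fin 2) w.Completion) * A.map (infiniteAdeleEval K w) *
        ((g⁻¹ : GL (Fin 2) w.Completion) : Matrix (Fin 2) (Fin 2) w.Completion) = B.map (infiniteAdeleEval K w) := fun w =>
    exists_units_conj_eq_of_discr_ne_zero _ _ (by rw [(hAi w).1, (hBi w).1]) (by rw [(hAi w).2, (hBi w).2])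
      (by rw [(hAi w).1, (hAi w).2]; exact hdiscI w)
  choose gi hgi using keyi
  -- assemble
  have hcof : ∀ᶠ w in Filter.cofinite, w ∉ T := hTf.compl_mem_cofinite
  set Qm : Matrix (Fin 2) (Fin 2) (AdeleRing (𝓞 K) K) := matrixAdeleOfLocal K (fun w => (gi w : Matrix (Fin 2) (Fin 2) w.Completion))
    (fun w => (g w : Matrix (Fin 2) (Fin 2) (w.adicCompletion K))) (hcof.mono fun w hw => ((hg w).2 hw).1) with hQm
  set Qi : Matrix (Fin 2) (Fin 2) (AdeleRing (𝓞 K) K) := matrixAdeleOfLocal K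
    (fun w => ((gi w)⁻¹ : GL (Fin 2) w.Completion))
    (fun w => ((g w)⁻¹ : GL (Fin 2) (w.adicCompletion K))) (hcof.mono fun w hw => ((hg w).2 hw).2) with hQi
  have hmul1 : Qm * Qi = 1 := by
    refine matrix_adele_ext K (fun w => ?_) (fun w => ?_)
    · rw [Matrix.map_mul, hQm, hQi, matrixAdeleOfLocal_map_infiniteAdeleEval, matrixAdeleOfLocal_map_infiniteAdeleEval,
        Matrix.map_one _ (map_zero _) (map_one _), ← Units.val_mul, mul_inv_cancel, Units.val_one]
    · rw [Matrix.map_mul, hQm, hQi, matrixAdeleOfLocal_map_adeleEval, matrixAdeleOfLocal_map_adeleEval,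
        Matrix.map_one _ (map_zero _) (map_one _), ← Units.val_mul, mul_inv_cancel, Units.val_one]
  have hmul2 : Qi * Qm = 1 := by
    refine matrix_adele_ext K (fun w => ?_) (fun w => ?_)
    · rw [Matrix.map_mul, hQm, hQi, matrixAdeleOfLocal_map_infiniteAdeleEval, matrixAdeleOfLocal_map_infiniteAdeleEval,
        Matrix.map_one _ (map_zero _) (map_one _), ← Units.val_mul, inv_mul_cancel, Units.val_one]
    · rw [Matrix.map_mul, hQm, hQi, matrixAdeleOfLocal_map_adeleEval, matrixAdeleOfLocal_map_adeleEval,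
        Matrix.map_one _ (map_zero _) (map_one _), ← Units.val_mul, inv_mul_cancel, Units.val_one]
  refine ⟨⟨Qm, Qi, hmul1, hmul2⟩, fun w => ?_, fun w hw => ?_⟩
  · change (Qm * A * Qi).map (infiniteAdeleEval K w) = _
    rw [Matrix.map_mul, Matrix.map_mul, hQm, hQi, matrixAdeleOfLocal_map_infiniteAdeleEval,
      matrixAdeleOfLocal_map_infiniteAdeleEval]
    exact hgi w
  · change (Qm * A * Qi).map (AdelicGroupData.adeleEval K w) = _
    rw [Matrix.map_mul, Matrix.map_mul, hQm, hQi, matrixAdeleOfLocal_map_adeleEval, matrixAdeleOfLocal_map_adeleEval]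
    exact (hg w).1 hw

end Assembly

end Literature.NumberTheory.Automorphic
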